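import Mathlib.Analysis.SpecialFunctions.Pow.Real
import Mathlib.Analysis.SpecialFunctions.Log.Base
import Literature.Computability.Complexity.ConstantDepth
import Literature.Computability.Complexity.CircuitLowerBounds
import Literature.Computability.Complexity.CircuitClasses
import Literature.Computability.Complexity.VeryLargeCliques
import Literature.Barriers.PneNP.Locality
import Literature.Barriers.PneNP.LocalityE1Proofs
import HarnessLib

/-!
# HM Frontier E — `(n-k)`-Clique versus `AC⁰_d[m^{1+ε}]` (CHOPRS, Prop. 31), typed next to its
# PROVED locality barrier

Source: L. Chen, S. Hirahara, I. C. Oliveira, J. Pich, N. Rajgopal, R. Santhanam, *Beyond natural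
proofs: hardness magnification and locality*, ITCS 2020 / J. ACM 69 (2022), arXiv:1911.08297
(held: `paper:arxiv-1911.08297`; bib key `arXiv191108297`). Census packet
`papers/PneNP/magnification-census`, row R25 (cell `pub-magnif`, 2026-08-18).

WHAT IS VENDORED (statement level, unproved here — a NAMED FACT used as a hypothesis):
* `chop_prop31` — Prop. 31 (arXiv p. 18, §3.4; = item E1 of HM Frontier E, p. 4; from
  Oliveira–Santhanam FOCS 2018 Thm. 7 for `k`-Vertex-Cover by complementing the graph):
  "Let k(n) = (log n)^C for some constant C. If there exists ε > 0 such that for every depth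
  d ≥ 1, (n−k)-Clique ∉ AC⁰_d[m^{1+ε}], then NP ⊄ NC¹."

RENDERING (each choice makes OUR hypothesis imply the printed one, so the vendored implication is a
consequence of the printed theorem):
* the graph on `n` vertices is given by its `m = n.choose 2` edge indicators
  (`(⊤ : SimpleGraph (Fin n)).edgeSet → Bool`), and `(n-k)`-Clique is the tree's
  `Literature.Computability.Complexity.cliqueFn n (n - k n)` ("has a clique on `n - k(n)`
  vertices") with `k n = ⌊(log₂ n)^C⌋` — the SAME function the locality barrier
  `Literature.Barriers.PneNP.Locality` speaks about, `C ≥ 1` an integer exponent;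
* `AC⁰_d[s]`: circuits over `acBasis` (unbounded fan-in `∧`, `∨`, and `¬`), `acDepth ≤ d`
  (negations free, as in `Locality`), `size ≤ s` counted in GATES (Oliveira–Santhanam §2.1); the
  size bound `m^{1+ε}` is rounded UP to `⌈m^{1+ε}⌉₊` (more circuits fall under the budget, so
  "no such circuit exists" is a STRONGER statement than the printed one ⇒ safe);
* "`∉ AC⁰_d[m^{1+ε}]`" for a function family is rendered "for infinitely many `n` there is no such
  circuit" (`∃ᶠ n in atTop`), which is the reading under the almost-everywhere class convention and
  is stronger than the every-length reading — safe either way.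

WHAT THIS FILE ADDS (proved, no new mathematics): the LOCALIZED form of the hypothesis — the
statement a lower-bound proof would establish if it were insensitive to one extra oracle gate of
fan-in `c·(⌊log₂ n⌋+1)^{4C}` (CHOPRS Def. 11) — implies the plain hypothesis
(`cliqueAC0LowerBound_of_local`) and is FALSE for every `C ≥ 1`, `ε > 0`
(`not_localCliqueAC0LowerBound`, from the tree THEOREM `Literature.Barriers.PneNP.Locality_holds`,
CHOPRS Prop. 50 E1^𝒪). So row R25 of the census is the one row whose barrier is a theorem of the
tree stated over literally the same function and size budget as the gap.

ALSO (audit corollary, appended 2026-08-18): `not_oracle_monotone_simulation_of_jukna96` — with the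
Andreev–Jukna monotone bound vendored as `Literature.Computability.Complexity.jukna_prop96`
(Jukna 2012 Prop. 9.6) the hypothesis `hE4` of `Locality.not_oracle_monotone_simulation` is a
theorem for `C ≥ 4`, so the monotone route to R25 is provably outside the localizing class.

NOT VENDORED: OS18 Thm. 7 itself (`k`-Vertex-Cover, hypothesis "∀ d ∃ ε_d"), of which Prop. 31
("∃ ε ∀ d") is the "slightly weaker form" (CHOPRS p. 18); the monotone bound E4 / Prop. 32
(Andreev–Jukna) lives in `Literature/Computability/Complexity/VeryLargeCliques.lean` — a different
(monotone) model, census: MODEL-MISMATCH, no same-model bound for `(n-k)`-Clique at `k = polylog`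
is in print.
-/

noncomputable section

open Classical Filter Topology

namespace Literature.Computability.MetaComplexity

open Literature.Computability.Complexity Literature.Computability.Complexity.Nondeterministic

/-! ### The hypothesis of Prop. 31 and its localized form -/

/-- **`(n-k)`-Clique `∉ AC⁰_d[m^{1+ε}]` at every depth, `k = ⌊(log₂ n)^C⌋`** (the hypothesis of
CHOPRS Prop. 31 for the exponent `C` and the constant `ε`): for every depth `d ≥ 1`, for
infinitely many `n`, no circuit over `∧, ∨, ¬` (unbounded fan-in) of `acDepth ≤ d` and at most
`⌈(n choose 2)^{1+ε}⌉` gates computes `cliqueFn n (n - ⌊(log₂ n)^C⌋)` on the `n choose 2` edge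
variables. OPEN for every `C ≥ 1`, `ε > 0` (census R25: no `AC⁰` lower bound for `(n-k)`-Clique
at `k = polylog n` is in print; the monotone bound of Andreev–Jukna is a different model).
[cite: arXiv191108297, Prop. 31 (hypothesis); §1.1 item E1] -/
def CliqueAC0LowerBound (C : ℕ) (ε : ℝ) : Prop :=
  ∀ d : ℕ, 1 ≤ d → ∃ᶠ n : ℕ in atTop,
    ¬ ∃ E : Circuit ((⊤ : SimpleGraph (Fin n)).edgeSet),
      E.IsOver acBasis ∧ E.acDepth ≤ d ∧ E.size ≤ ⌈((n.choose 2 : ℕ) : ℝ) ^ (1 + ε)⌉₊ ∧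
        E.Computes (cliqueFn n (n - ⌊Real.logb 2 n ^ C⌋₊))

/-- **CHOPRS Prop. 31 (HM Frontier E, item E1) as a named fact**: *"Let k(n) = (log n)^C for
some constant C. If there exists ε > 0 such that for every depth d ≥ 1, (n−k)-Clique ∉
AC⁰_d[m^{1+ε}], then NP ⊄ NC¹."* (arXiv:1911.08297 p. 18; proof there: reduction to
Oliveira–Santhanam's magnification theorem for `k`-Vertex-Cover, FOCS 2018 Thm. 7, since
"by negating input literals, the complexities of (n−k)-Clique and k-Vertex-Cover are equivalent
with respect to AC⁰ circuits"). Rendering: module docstring (integer `C ≥ 1`, `⌊(log₂ n)^C⌋`,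
gates, `⌈m^{1+ε}⌉`, i.o. failure), each choice weaker-or-equal. Users take `(h : chop_prop31)`.
[cite: arXiv191108297, Prop. 31] -/
def chop_prop31 : Prop :=
  ∀ C : ℕ, 1 ≤ C → ∀ ε : ℝ, 0 < ε → CliqueAC0LowerBound C ε → ¬ (NP ⊆ NC1)

/-- **The LOCALIZED hypothesis** (what a lower-bound argument for `CliqueAC0LowerBound C ε` would
prove if it localized in the sense of CHOPRS Def. 11 with one oracle gate of fan-in
`c·(⌊log₂ n⌋+1)^{4C}`): for every depth `d ≥ 1`, EVERY oracle language `𝒪` and every constant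
`c`, for infinitely many `n` no `[d, ⌈m^{1+ε}⌉, 1, c(⌊log₂ n⌋+1)^{4C}]`-local circuit
(`Circuit.IsLocalAC`) computes `cliqueFn n (n - ⌊(log₂ n)^C⌋)`. This is literally the statement
negated by `Literature.Barriers.PneNP.Locality.not_localizing_clique_lower_bound`.
[cite: arXiv191108297, Def. 11 and Prop. 50 (E1^𝒪)] -/
def LocalCliqueAC0LowerBound (C : ℕ) (ε : ℝ) : Prop :=
  ∀ d : ℕ, 1 ≤ d → ∀ (𝒪 : Language Bool) (c : ℕ), ∃ᶠ n : ℕ in atTop,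
    ¬ ∃ E : Circuit ((⊤ : SimpleGraph (Fin n)).edgeSet),
      E.IsLocalAC 𝒪 d ⌈((n.choose 2 : ℕ) : ℝ) ^ (1 + ε)⌉₊ 1 (c * (Nat.log 2 n + 1) ^ (4 * C)) ∧
        E.Computes (cliqueFn n (n - ⌊Real.logb 2 n ^ C⌋₊))

/-! ### API -/

/-- Consequence shape of Prop. 31: a proof of the hypothesis for one exponent `C ≥ 1` and one
`ε > 0` gives `NP ⊄ NC¹`. [cite: arXiv191108297, Prop. 31] -/
theorem NP_not_subset_NC1_of_cliqueAC0LowerBound (h : chop_prop31) {C : ℕ} (hC : 1 ≤ C)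
    {ε : ℝ} (hε : 0 < ε) (hlb : CliqueAC0LowerBound C ε) : ¬ (NP ⊆ NC1) :=
  h C hC ε hε hlb

/-- Monotonicity in `ε`: hardness against `⌈m^{1+ε}⌉` gates implies hardness against
`⌈m^{1+ε'}⌉` gates for `0 ≤ ε' ≤ ε`. [folklore] -/
theorem CliqueAC0LowerBound.mono {C : ℕ} {ε ε' : ℝ} (hε' : 0 ≤ ε') (hle : ε' ≤ ε)
    (h : CliqueAC0LowerBound C ε) : CliqueAC0LowerBound C ε' := by
  intro d hd
  refine (h d hd).mono fun n hn ⟨E, hO, hdep, hsz, hcomp⟩ => hn ⟨E, hO, hdep, hsz.trans ?_, hcomp⟩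
  rcases Nat.eq_zero_or_pos (n.choose 2) with h0 | hpos
  · rw [h0, Nat.cast_zero, Real.zero_rpow (by linarith), Real.zero_rpow (by linarith)]
  · exact Nat.ceil_mono (Real.rpow_le_rpow_of_exponent_le (by exact_mod_cast hpos) (by linarith))

/-- A localizing lower bound is in particular a lower bound: an ordinary `AC⁰` circuit is a local
circuit for any oracle (`Circuit.isLocalAC_of_isOver`), so if no local circuit computes the clique
function then no plain one does. [cite: arXiv191108297, Def. 11 (§2.5)] -/
theorem cliqueAC0LowerBound_of_local {C : ℕ} {ε : ℝ} (h : LocalCliqueAC0LowerBound C ε) :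
    CliqueAC0LowerBound C ε := by
  intro d hd
  refine (h d hd (0 : Language Bool) 0).mono fun n hn ⟨E, hO, hdep, hsz, hcomp⟩ => hn ?_
  exact ⟨E, Circuit.isLocalAC_of_isOver hO _ hdep hsz _ _, hcomp⟩

/-- **The localized hypothesis is false** for every exponent `C ≥ 1` and every `ε > 0`: this is
the tree THEOREM `Literature.Barriers.PneNP.Locality_holds` (CHOPRS Prop. 50, E1^𝒪: for large
depth `(n-k)`-Clique HAS `m^{1+ε_d}`-size local circuits with one polylog-fan-in oracle gate,
`ε_d → 0`) through `Locality.not_localizing_clique_lower_bound`. Hence any proof of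
`CliqueAC0LowerBound C ε` must be sensitive to a single oracle gate of fan-in
`O((log n)^{4C})` — the census's barrier column for R25, as a theorem.
[cite: arXiv191108297, Prop. 50 (E1^𝒪) and §1.3] -/
theorem not_localCliqueAC0LowerBound {C : ℕ} (hC : 1 ≤ C) {ε : ℝ} (hε : 0 < ε) :
    ¬ LocalCliqueAC0LowerBound C ε :=
  Literature.Barriers.PneNP.Locality_holds.not_localizing_clique_lower_bound hC hε

/-- Non-vacuity of the model (referee rule F1): at every `n ≥ 2` and for all budgets `d, s` some
function of the edge variables IS computed by an `AC⁰` circuit within the budgets — the projection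
onto the edge `{0,1}` by the gate-free circuit `Circuit.input`. So `CliqueAC0LowerBound` speaks
about an inhabited class. [folklore] -/
theorem exists_ac0_circuit_computes {n : ℕ} (hn : 2 ≤ n) (d s : ℕ) :
    ∃ (f : ((⊤ : SimpleGraph (Fin n)).edgeSet → Bool) → Bool)
      (E : Circuit ((⊤ : SimpleGraph (Fin n)).edgeSet)),
      E.IsOver acBasis ∧ E.acDepth ≤ d ∧ E.size ≤ s ∧ E.Computes f := by
  have h01 : (⟨0, by omega⟩ : Fin n) ≠ ⟨1, by omega⟩ := by simp
  let e : (⊤ : SimpleGraph (Fin n)).edgeSet :=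
    ⟨s(⟨0, by omega⟩, ⟨1, by omega⟩), by simp [h01]⟩
  refine ⟨fun x => x e, Circuit.input e, ?_, ?_, ?_, fun x => rfl⟩
  · intro g hg; simp [Circuit.input] at hg
  · simp [Circuit.acDepth, Circuit.depthWith, Circuit.input]
  · simp

/-! ### The monotone route (E4 + monotone simulation) is provably non-localizing, modulo one
cited fact -/

/-- **Audit corollary (census R25, barrier column):** given the Andreev–Jukna monotone bound in
the form `Literature.Computability.Complexity.jukna_prop96` (Jukna 2012, Prop. 9.6: monotone
circuits for `CLIQUE(n, n-k)` need `2^{Ω(k^{1/3})}` gates for `k ≤ n/2`), the hypothesis `hE4`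
of `Literature.Barriers.PneNP.Locality.not_oracle_monotone_simulation` holds for every integer
exponent `C ≥ 4` (`cliqueFn_polylog_superpolynomial_frequently`), so — with the tree theorem
`Locality_holds` — the relativized monotone simulation "every monotone function of the edge
variables computed by a `[1, c(⌊log₂ n⌋+1)^{4C}, 1]`-local depth-`d` circuit of size
`⌈m^{1+ε}⌉` has monotone complexity `≤ n^p` for some `p`, for large `n`" is FALSE. Reading: the
route E4 + "`AC⁰_d[m^{1+ε}] ∩ Mono ⊆ mSIZE[poly]`" ⇒ `CliqueAC0LowerBound` ⇒ (Prop. 31)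
`NP ⊄ NC¹` can only be completed by an argument sensitive to the oracle gate; it is not excluded
by `not_localCliqueAC0LowerBound`. No new mathematics: modus ponens of two tree theorems and one
named fact. [cite: arXiv191108297, §1.1 (E) p. 4 and §1.3 p. 7] [cite: Jukna2012, Prop. 9.6] -/
theorem not_oracle_monotone_simulation_of_jukna96 (h : jukna_prop96) {C : ℕ} (hC : 4 ≤ C) :
    ¬ ∀ (d : ℕ) (𝒪 : Language Bool) (c : ℕ) (ε : ℝ), 0 < ε → ∃ p : ℕ, ∀ᶠ n : ℕ in atTop,
        ∀ f : (((⊤ : SimpleGraph (Fin n)).edgeSet → Bool) → Bool), Monotone f →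
          ∀ E : Circuit ((⊤ : SimpleGraph (Fin n)).edgeSet),
            E.IsLocalAC 𝒪 d ⌈((n.choose 2 : ℕ) : ℝ) ^ (1 + ε)⌉₊ 1 (c * (Nat.log 2 n + 1) ^ (4 * C)) →
              E.Computes f → circuitSizeOver monotoneBasis f ≤ n ^ p :=
  Literature.Barriers.PneNP.Locality_holds.not_oracle_monotone_simulation (by omega)
    (cliqueFn_polylog_superpolynomial_frequently h hC)

end Literature.Computability.MetaComplexity
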